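import Mathlib.AlgebraicGeometry.Morphisms.Integral
import Mathlib.FieldTheory.IsAlgClosed.AlgebraicClosure
import Mathlib.RingTheory.Algebraic.Cardinality
import Mathlib.Analysis.Complex.Polynomial.Basic
import Literature.AlgebraicGeometry.Motives.FiberBaseChange
import HarnessLib

/-!
# Base change along an algebraic extension of the ground field: families, and generic points

Topic `Literature/AlgebraicGeometry/Motives` (family `hodge`). Theorems only (no definition, no
named fact; D-0026). Textbook plumbing on the real carriers `Motives/BaseChange.lean`
(`baseChangeHom σ : SchemeOver k ⥤ SchemeOver L`) and `Motives/FiberBaseChange.lean`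
(`baseChangeHomObjIsoOfComp`: transitivity of base change along `τ ∘ σ = ρ`, Görtz–Wedhorn I,
Prop. 4.16), used to replace a countable field of definition `k ⊂ ℂ` of a family by its algebraic
closure inside `ℂ` in the spreading argument for the variational Hodge conjecture (so that the
complexification of an integral `k`-variety is irreducible):

* `baseChangeHomObjIsoOfComp_comm` — transitivity of base change is NATURAL: for a `k`-morphism
  `f₀ : 𝒳₀ ⟶ S₀` the isomorphisms `(𝒳₀ ⊗_σ L) ⊗_τ M ≅ 𝒳₀ ⊗_ρ M`, `(S₀ ⊗_σ L) ⊗_τ M ≅ S₀ ⊗_ρ M`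
  form an isomorphism of families `(f₀ ⊗_σ L) ⊗_τ M ≅ f₀ ⊗_ρ M` (Görtz–Wedhorn I, Prop. 4.16).
* `apply_eq_genericPoint_of_isIntegralHom` — **incomparability for integral morphisms**: for an
  integral morphism `f : X ⟶ Y` of integral schemes, a point of `X` over the generic point of `Y`
  is the generic point of `X` (Atiyah–Macdonald, Cor. 5.9: primes of an integral extension lying
  over the same prime are incomparable; Mathlib `Ideal.eq_bot_of_comap_eq_bot`).
* `baseChangeHomFst_isIntegralHom` — `S₀ ⊗_σ k' → S₀` is integral for `k'/σ(k)` integral;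
  `eq_genericPoint_of_baseChangeHomFst_eq` — hence a point of `S₀ ⊗_σ k'` over the generic point
  of `S₀` is the generic point (both integral).
* `exists_countable_isAlgClosed_factor` — a homomorphism `σ : k →+* ℂ` from a countable field
  factors as `k → k' → ℂ` with `k'` a COUNTABLE ALGEBRAICALLY CLOSED field, integral over `k`
  (the algebraic closure of `k`, embedded into `ℂ` by `IsAlgClosed.lift`; countable by
  `Algebra.IsAlgebraic.cardinalMk_le_max`).

## References

* [GortzWedhorn2020] U. Görtz, T. Wedhorn, Algebraic Geometry I (2nd ed. 2020), Prop. 4.16, §(4.7).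
* [AtiyahMacdonald1969] M. Atiyah, I. Macdonald, Introduction to Commutative Algebra (1969),
  Cor. 5.9.
* [Lang2002] S. Lang, Algebra (3rd ed. 2002), V §2 (algebraic closure, Thm. 2.8) and VIII §4.
-/

noncomputable section

open CategoryTheory CategoryTheory.Limits AlgebraicGeometry TopologicalSpace

namespace Literature.AlgebraicGeometry.Motives

/-! ## Transitivity of base change is natural in the family -/

section Comp

variable {k L M : Type} [Field k] [Field L] [Field M] (σ : k →+* L) (τ : L →+* M) (ρ : k →+* M)
  (h : τ.comp σ = ρ) {𝒳₀ S₀ : SchemeOver k} (f₀ : 𝒳₀ ⟶ S₀)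

/-- **Transitivity of base change is an isomorphism of FAMILIES** (Görtz–Wedhorn I, Prop. 4.16,
naturality of `X_{(S')} ×_{S'} S'' ≅ X_{(S'')}` in `X`): for `f₀ : 𝒳₀ ⟶ S₀` over `k` and
`τ ∘ σ = ρ`, the square formed by `(f₀ ⊗_σ L) ⊗_τ M`, `f₀ ⊗_ρ M` and the isomorphisms
`baseChangeHomObjIsoOfComp` of total spaces and bases commutes. [cite: GortzWedhorn2020, Prop. 4.16 and §(4.7)] -/
@[reassoc]
theorem baseChangeHomObjIsoOfComp_comm :
    (baseChangeHom τ).map ((baseChangeHom σ).map f₀) ≫ (baseChangeHomObjIsoOfComp σ τ ρ h S₀).hom =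
      (baseChangeHomObjIsoOfComp σ τ ρ h 𝒳₀).hom ≫ (baseChangeHom ρ).map f₀ := by
  ext : 1
  change ((baseChangeHom τ).map ((baseChangeHom σ).map f₀)).left ≫
      (baseChangeHomObjIsoOfComp σ τ ρ h S₀).hom.left =
    (baseChangeHomObjIsoOfComp σ τ ρ h 𝒳₀).hom.left ≫ ((baseChangeHom ρ).map f₀).left
  have eL : ((baseChangeHom τ).map ((baseChangeHom σ).map f₀)).left ≫
      (baseChangeHomObjIsoOfComp σ τ ρ h S₀).hom.left ≫ baseChangeHomFst ρ S₀ =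
      baseChangeHomFst τ ((baseChangeHom σ).obj 𝒳₀) ≫ baseChangeHomFst σ 𝒳₀ ≫ f₀.left := by
    rw [baseChangeHomObjIsoOfComp_hom_left_fst, ← Category.assoc, baseChangeHom_map_left_comp_fst,
      Category.assoc, baseChangeHom_map_left_comp_fst]
  have eR : (baseChangeHomObjIsoOfComp σ τ ρ h 𝒳₀).hom.left ≫ ((baseChangeHom ρ).map f₀).left ≫
      baseChangeHomFst ρ S₀ =
      baseChangeHomFst τ ((baseChangeHom σ).obj 𝒳₀) ≫ baseChangeHomFst σ 𝒳₀ ≫ f₀.left := by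
    rw [baseChangeHom_map_left_comp_fst, ← Category.assoc, baseChangeHomObjIsoOfComp_hom_left_fst,
      Category.assoc]
  apply pullback.hom_ext
  · -- first projections to `S₀`
    change (_ ≫ _) ≫ baseChangeHomFst ρ S₀ = (_ ≫ _) ≫ baseChangeHomFst ρ S₀
    rw [Category.assoc, Category.assoc, eL, eR]
  · -- structure maps to `Spec M`
    change (_ ≫ _) ≫ ((baseChangeHom ρ).obj S₀).hom = (_ ≫ _) ≫ ((baseChangeHom ρ).obj S₀).hom
    simp only [Category.assoc, Over.w]

end Comp

/-! ## Incomparability: points over the generic point of an integral morphism -/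

section Integral

/-- **Incomparability for an integral morphism of affine integral schemes**: a point over the
generic point is the generic point (Atiyah–Macdonald, Cor. 5.9, in the form
`Ideal.eq_bot_of_comap_eq_bot`: a prime of the integral domain `Γ(X)`, integral over `Γ(Y)`,
contracting to `0` is `0`). [cite: AtiyahMacdonald1969, Cor. 5.9] -/
theorem apply_eq_genericPoint_of_isIntegralHom_of_isAffine {X Y : Scheme} [IsAffine X]
    [IsAffine Y] [IsIntegral X] [IsIntegral Y] (f : X ⟶ Y) [IsIntegralHom f] {x : X}
    (hx : f x = genericPoint Y) : x = genericPoint X := by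
  classical
  haveI : Nonempty (↑(⊤ : X.Opens) : Set X) := ⟨⟨genericPoint X, trivial⟩⟩
  haveI : Nonempty (↑(⊤ : Y.Opens) : Set Y) := ⟨⟨genericPoint Y, trivial⟩⟩
  haveI : IsDomain Γ(X, ⊤) := inferInstance
  haveI : IsDomain Γ(Y, ⊤) := inferInstance
  let φ : Γ(Y, ⊤) ⟶ Γ(X, ⊤) := f.appTop
  have hφ : φ.hom.IsIntegral := f.isIntegral_app ⊤ (isAffineOpen_top Y)
  letI : Algebra Γ(Y, ⊤) Γ(X, ⊤) := φ.hom.toAlgebra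
  haveI : Algebra.IsIntegral Γ(Y, ⊤) Γ(X, ⊤) := ⟨fun a => hφ a⟩
  -- the prime of `x` contracts to the zero ideal
  have h1 : (Spec.map φ) (X.toSpecΓ x) = Y.toSpecΓ (f x) := by
    rw [← Scheme.Hom.comp_apply, ← Scheme.toSpecΓ_naturality, Scheme.Hom.comp_apply]
  rw [hx, genericPoint_eq_of_isOpenImmersion Y.toSpecΓ, genericPoint_eq_bot_of_affine] at h1
  have h2 := congrArg PrimeSpectrum.asIdeal h1
  change Ideal.comap φ.hom (X.toSpecΓ x).asIdeal = ⊥ at h2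
  have h3 : (X.toSpecΓ x).asIdeal = ⊥ := Ideal.eq_bot_of_comap_eq_bot h2
  -- hence `x` is the generic point
  have h4 : X.toSpecΓ x = X.toSpecΓ (genericPoint X) := by
    rw [genericPoint_eq_of_isOpenImmersion X.toSpecΓ, genericPoint_eq_bot_of_affine]
    exact PrimeSpectrum.ext h3
  exact X.toSpecΓ.isOpenEmbedding.injective h4

/-- **Incomparability for an integral morphism of integral schemes**: for `f : X ⟶ Y` integral
with `X`, `Y` integral, a point of `X` lying over the generic point of `Y` is the generic point of
`X` (restrict to an affine open neighbourhood of the generic point of `Y` and its affine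
preimage). [cite: AtiyahMacdonald1969, Cor. 5.9] -/
theorem apply_eq_genericPoint_of_isIntegralHom {X Y : Scheme} [IsIntegral X] [IsIntegral Y]
    (f : X ⟶ Y) [IsIntegralHom f] {x : X} (hx : f x = genericPoint Y) : x = genericPoint X := by
  classical
  obtain ⟨_, ⟨U', hU, rfl⟩, hηU', -⟩ := Y.isBasis_affineOpens.exists_subset_of_mem_open
    (Set.mem_univ (genericPoint Y)) isOpen_univ
  let U : Y.Opens := U'
  have hηU : genericPoint Y ∈ U := hηU'
  have hxU : x ∈ f ⁻¹ᵁ U := by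
    change f x ∈ U
    rw [hx]; exact hηU
  haveI : IsAffine U.toScheme := hU
  haveI : IsAffine (f ⁻¹ᵁ U).toScheme := hU.preimage f
  haveI : Nonempty U.toScheme := ⟨⟨_, hηU⟩⟩
  haveI : Nonempty (f ⁻¹ᵁ U).toScheme := ⟨⟨x, hxU⟩⟩
  haveI : IsIntegral U.toScheme := inferInstance
  haveI : IsIntegral (f ⁻¹ᵁ U).toScheme := inferInstance
  have hx' : (f ∣_ U) ⟨x, hxU⟩ = genericPoint U.toScheme := by
    apply U.ι.isOpenEmbedding.injective
    rw [genericPoint_eq_of_isOpenImmersion U.ι, ← Scheme.Hom.comp_apply, morphismRestrict_ι,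
      Scheme.Hom.comp_apply]
    exact hx
  have key := apply_eq_genericPoint_of_isIntegralHom_of_isAffine (f ∣_ U) hx'
  have h := congrArg (fun z => (f ⁻¹ᵁ U).ι z) key
  simp only at h
  rw [genericPoint_eq_of_isOpenImmersion (f ⁻¹ᵁ U).ι] at h
  exact h

variable {k k' : Type} [Field k] [Field k'] (σ : k →+* k')

/-- `Spec k' → Spec k` is an integral morphism when `k'` is integral over `σ(k)`. [cite: AtiyahMacdonald1969, Cor. 5.9 (setting)] -/
theorem isIntegralHom_specMap_of_isIntegral (hσ : σ.IsIntegral) :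
    IsIntegralHom (Spec.map (CommRingCat.ofHom σ)) :=
  IsIntegralHom.SpecMap_iff.mpr hσ

/-- **The projection `S₀ ⊗_σ k' → S₀` is an integral morphism** when `k'` is integral over `σ(k)`
(base change of the integral morphism `Spec k' → Spec k`). [cite: AtiyahMacdonald1969, Cor. 5.9 (setting)] -/
theorem baseChangeHomFst_isIntegralHom (hσ : σ.IsIntegral) (S₀ : SchemeOver k) :
    IsIntegralHom (baseChangeHomFst σ S₀) := by
  haveI := isIntegralHom_specMap_of_isIntegral σ hσ
  exact MorphismProperty.pullback_fst (P := @IsIntegralHom) _ _ inferInstance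

/-- **A point of `S₀ ⊗_σ k'` over the generic point of `S₀` is the generic point** when
`k'/σ(k)` is integral and both schemes are integral (incomparability along the integral projection
`S₀ ⊗_σ k' → S₀`). Used with `k'` the algebraic closure of a countable field of definition: a
complex point of `S₀ ⊗ ℂ` generic over `k` stays generic over `k'`. [cite: AtiyahMacdonald1969, Cor. 5.9] -/
theorem eq_genericPoint_of_baseChangeHomFst_eq (hσ : σ.IsIntegral) (S₀ : SchemeOver k)
    [IsIntegral S₀.left] [IsIntegral ((baseChangeHom σ).obj S₀).left]
    {x : ((baseChangeHom σ).obj S₀).left} (hx : baseChangeHomFst σ S₀ x = genericPoint S₀.left) :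
    x = genericPoint ((baseChangeHom σ).obj S₀).left := by
  haveI := baseChangeHomFst_isIntegralHom σ hσ S₀
  exact apply_eq_genericPoint_of_isIntegralHom (baseChangeHomFst σ S₀) hx

end Integral

/-! ## A countable algebraically closed intermediate field -/

section AlgClosure

open Cardinal

/-- **Every homomorphism `σ : k →+* ℂ` from a countable field factors through a countable
algebraically closed field integral over `k`**: `k → k̄ → ℂ` with `k̄` an algebraic closure of `k`
(Lang, *Algebra*, V Thm. 2.8: the embedding of an algebraic extension into an algebraically closed
field extends `σ`; Mathlib `IsAlgClosed.lift`), countable as an algebraic extension of a countable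
field. [cite: Lang2002, V §2 Thm. 2.8] -/
theorem exists_countable_isAlgClosed_factor {k : Type} [Field k] [Countable k] (σ : k →+* ℂ) :
    ∃ (k' : Type) (_ : Field k') (_ : Countable k') (_ : IsAlgClosed k') (σ' : k →+* k')
      (τ : k' →+* ℂ), σ'.IsIntegral ∧ τ.comp σ' = σ := by
  letI : Algebra k ℂ := σ.toAlgebra
  let k' := AlgebraicClosure k
  haveI : Countable k' := by
    rw [← Cardinal.mk_le_aleph0_iff]
    exact (Algebra.IsAlgebraic.cardinalMk_le_max k k').trans (max_le Cardinal.mk_le_aleph0 le_rfl)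
  let τ : k' →ₐ[k] ℂ := IsAlgClosed.lift
  refine ⟨k', inferInstance, inferInstance, inferInstance, algebraMap k k', τ.toRingHom, ?_, ?_⟩
  · exact Algebra.IsIntegral.isIntegral
  · exact τ.comp_algebraMap

end AlgClosure

end Literature.AlgebraicGeometry.Motives

end
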